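import Literature.MathematicalPhysics.QuantumFieldTheory.Balaban1983to89.B9SmoothHolderClassTFromGradient
import Literature.MathematicalPhysics.QuantumFieldTheory.Balaban1983to89.B9SmoothHolderClassP
import Literature.MathematicalPhysics.QuantumFieldTheory.Balaban1983to89.B9RWSums346Schur

/-!
# `Balaban1983to89.B9GradViaDivLettersPrintWeight` — the transported `J`-letter and the gradient-member producer AT THE PRINT-WEIGHTED CLASSES:
# `J_μ(U) : bHZP (taxiS U) s → bHZKP (taxiB U) s` (the common weight `(Lʲη)^{s−1}` moved by [4] (2.60)), its graded projection out of `bHZPG`, and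
# (3.43) as a class statement: a `𝔠^{(−1)}` sup member plus a `𝔠⁽⁰⁾` gradient member land ONCE in the graded pin `bHZPG (taxiS U) w`

T. Bałaban, *Propagators for lattice gauge theories in a background field*, Commun. Math. Phys. **99** (1985) 389–434
[`Balaban1985BackgroundPropagators`, "B9"]; [4] = T. Bałaban, *Propagators and renormalization transformations for lattice gauge
theories. II*, Commun. Math. Phys. **96** (1984) 223–250 [`Balaban1984PropagatorsII`].

statement-level skeleton of published theorems with citation tags; proofs where landed; nothing here is a claim about the
Yang–Mills mass gap

THE PRINTED LOCI.  [B9] (3.3) p. 390 (`D_U = Σ_μ` of the directional derivatives), (3.40) p. 397, Thm 3.1 (3.43)–(3.45) p. 398, p. 398 (remark after (3.47):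
*"the choice of powers Lʲη is conventional … we may replace the factor (Lʲη)^α by (Lʲη)^β(Lʲ′η)^γ with β + γ = α"*); [4] Lemma 2.1 (2.60) p. 234, (2.51)–(2.54) pp. 232–233.

WHY THIS FILE (cell `pub-ymgap`, node N06, seat dag-n06-l g24; repair (A′) of LOCATED-U6, `BH13-UNITS-MEMO.md`: the (R3′) letter and the producer landing at the
print-weighted pins (P1′) `bXH := bHZKPG (taxiB U) wX`, (P2′) `bH13 := bHZPG (taxiS U) w13` of `B9SmoothHolderClassP`).
* §1 ★ `hasMaj_printWeight_of_transported` — ANY majorant `C·e^{−δd}` between the transported classes `bHZT g s s → bHZKT g′ s s` is the majorant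
  `C·L^{1−s}·e^{−(δ−αδ_F)d}` between the print-weighted classes `bHZP g s → bHZKP g′ s` (the common weight `(Lʲη)^{s−1}` crosses from `y′` to `y` by (2.60),
  `B9RWSums346Schur.scaleTransfer_len_rpow` at `γ = s − 1`);
* §2 ★★ `hasMaj_JcoKH_printWeight` — the transported `J`-letter of `B9GradViaDivLettersTransported.hasMaj_JcoKH_taxi` at `(ε, p) = (s, s)` re-weighted:
  `HasMaj (bHZP (taxiS U) s) (bHZKP (taxiB U) s) (J_μ(U)) (cR39·CJT ℓ s ϑ_L·e^{δ r_Z}·L^{1−s}·e^{−(δ−αδ_F)d})` from the gauge-invariant plaquette binder `hF`; ★★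
  `hasMaj_JcoKH_printGraded` — out of the graded pin `bHZPG (taxiS U) w` at one exponent (constant `(w s)⁻¹`), the (R3′) binder `hJ`;
* §3 ★★★ `hasMaj_into_bHZPG_of_grad` — the PRODUCER LANDING at (P2′): a sup member `T : b₁ → 𝔠^{(−1)}` (`|Tμ| ≤ (Lʲη)·C₀e^{−δd}`, (3.42)₂-type) and a gradient
  member `D_U∘T : b₁ → 𝔠⁽⁰⁾` (`|D_UTμ| ≤ C₁e^{−δd}`, (3.44)-type) give `HasMaj b₁ (bHZPG (taxiS U) w) T (L·(C₀e^{δ(r_near+1)} + (d+1)c_bC₁e^{δ(r_near+2(d+1)L²+2)})·e^{−δd})`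
  for EVERY weight function `0 ≤ w ≤ 1` — (3.43) for `G′∇\*`-type words read as one class statement (`B9SmoothHolderClassTFromGradient.hasMaj_into_bHZT_printWeight_of_grad`
  is s-uniform; `B9SmoothHolderClassP.hasMaj_into_bHZPG_of_le`).  This is the shape in which `Letters313DZ.rgdH` (`R∇\*_UG₁ = RG′∇\*`) becomes DERIVABLE at (P2′) from
  the certificate's own sup letter `rgd2` and a (3.44)-type gradient word.
HONEST SCOPE.  Bookkeeping over landed objects; the plaquette binder, the sup and gradient members are HYPOTHESES of printed species; nothing of [B9]∕[4] asserted; no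
pin, no certificate edit; COUNT-NEUTRAL; N06 NOT discharged; nothing continuum, nothing about the mass gap.  Cell `pub-ymgap` (HUMAN RULING D-0062), Track A node N06
[B9], seat `pub-ymgap-dag-n06-l` (g24), 2026-08-29.
-/

noncomputable section

namespace Literature.MathematicalPhysics.QuantumFieldTheory.Balaban1983to89.B9GradViaDivLettersPrintWeight

open B6Geom246MultiLevelTorus (geomT)
open B6GlobalChartV1 (PV blkV1)
open B6Ineq2142KLevelV1 (β lvl)
open B6KLevelCensusIndexV1 (KIdx)
open B6Prop22KLevelTorusCensusEta (nKT)
open B9GeoNormsKLevelV1 (geo9K)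
open B9GeoLemma21KLevelV1 (geo9K_len_pos geo9K_dist_comm)
open B9Thm34Ext (toB6)
open B9Thm39ReadingCoords (cR39 cR39_nonneg coordBound39 basisBound39)
open B9Thm312WholeClasses (cNormR)
open B9RWSums343to347Whole (Facts347)
open B9RWSums346Schur (scaleTransfer_len_rpow)
open B11SectG (BlockNorm HasMaj)
open B9SectDSup (weightNorm)
open B9CoReadingCoords (XBK blkBK)
open B9CoReadingCoordsS (XSK sIK blkSK)
open B9GradViaDivLettersAtPins (JcoKH)
open B9GradViaDivLettersSmoothTerms (rZ)
open B9GradViaDivLettersTransported (taxiS taxiB CJT CJT_nonneg hasMaj_JcoKH_taxi)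
open B9TaxiTransportLadder (plaqV)
open B9MultiscaleSmoothPartitionY (NearY)
open B9MultiscaleSmoothPartitionYNear (rNear dist_sIK_le_of_nearY)
open B9SmoothHolderClassS (Wscl Wscl_nonneg)
open B9SmoothHolderClassT (bHZT bHZKT)
open B9SmoothHolderClassTClosure (len_rpow_neg_eq_Wscl)
open B9SmoothHolderClassP (bHZP bHZKP bHZPG hasMaj_from_bHZPG hasMaj_into_bHZPG_of_le)
open B9SmoothHolderClassTFromGradient (hasMaj_into_bHZT_printWeight_of_grad)
open Node00 (SiteY FBondY IBondY CfgY toKT levY)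
open Node00.OpsYNablaBridge (chartY)
open Node00.OpsYSectDCoords (DvcoKH)
open T4RelativeLadder (UnitaryLike)

variable {d ℓ : ℕ} {hd : 1 ≤ d + 1} {hL : Odd (ℓ + 1) ∧ 1 < ℓ + 1} {b₀ b₁ : ℝ}
variable {𝔸 : Type} [NormedRing 𝔸] [NormedAlgebra ℂ 𝔸] [CompleteSpace 𝔸] [FiniteDimensional ℝ 𝔸]
variable {κ : Type} [Fintype κ]
variable (i : KIdx d ℓ hd hL b₀ b₁) [Fintype (geo9K i).Site] (b : Module.Basis κ ℝ 𝔸)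

/-! ## §1 From the transported classes to the print-weighted ones: the common weight crosses by (2.60) -/

section Reweight

variable {R₀ : ℝ} {H₀ : Prop} (gS : SiteY i → SiteY i → 𝔸ˣ) (gB : FBondY i → FBondY i → 𝔸ˣ)

omit [CompleteSpace 𝔸] [FiniteDimensional ℝ 𝔸] in
/-- ★ **RE-WEIGHTING A TRANSPORTED LETTER BY THE COMMON WEIGHT `(Lʲη)^{s−1}`**: a majorant `C·e^{−δd}` of `T : bHZT g_S s s → bHZKT g_B s s` is the majorant
`C·L^{1−s}·e^{−(δ−αδ_F)d}` of `T : bHZP g_S s → bHZKP g_B s` — the weight `(Lʲη)(y)^{s−1}` of the target against `(Lʲ′η)(y′)^{s−1}` of the source costs `L^{1−s}e^{αδ_F d}`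
by [4] (2.60) (`scaleTransfer_len_rpow`, `|s − 1| ≤ 1`). [cite: Balaban1985BackgroundPropagators, p.398 (remark after (3.47)); Balaban1984PropagatorsII, Lemma 2.1 (2.60) p.234] -/
theorem hasMaj_printWeight_of_transported {dF : ℕ} {δF α L₀ : ℝ} (hFa : Facts347 (geo9K i) R₀ H₀ dF δF α L₀)
    (hcf : |i.cf| = (nKT (toKT i) : ℝ)) {s : ℝ} (hs0 : 0 ≤ s) (hs1 : s ≤ 1)
    {T : (XSK κ i → ℝ) →ₗ[ℝ] (XBK κ i → ℝ)} {C δ : ℝ} (hC : 0 ≤ C)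
    (h : HasMaj (bHZT (κ := κ) i b gS (R := R₀) (H := H₀) (ε := s) (p := s) hs0 hs1 le_rfl)
      (bHZKT (κ := κ) i b gB (R := R₀) (H := H₀) (ε := s) (p := s) hs0 hs1 le_rfl) T (fun a a' => C * Real.exp (-(δ * (geo9K i).dist a a')))) :
    HasMaj (bHZP (κ := κ) i b gS (R := R₀) (H := H₀) (s := s) hs0 hs1) (bHZKP (κ := κ) i b gB (R := R₀) (H := H₀) (s := s) hs0 hs1) T
      (fun a a' => C * (geo9K i).L ^ (1 - s) * Real.exp (-((δ - α * δF) * (geo9K i).dist a a'))) := by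
  refine B9SectDSup.HasMaj.weight _ _ h fun y y' => ?_
  -- the weights at print's units: `Wscl (1−s) = (Lʲη)^{s−1}`
  have hW : ∀ z : IBondY i, Wscl i (1 - s) z = (geo9K i).len z ^ (s - 1) := fun z => by
    rw [← len_rpow_neg_eq_Wscl i hcf, neg_sub]
  have hγ : |s - 1| ≤ 4 := by rw [abs_sub_comm, abs_of_nonneg (by linarith)]; linarith
  have h1 := scaleTransfer_len_rpow hFa (s - 1) hγ y' y
  rw [geo9K_dist_comm i y' y, abs_sub_comm, abs_of_nonneg (by linarith : (0 : ℝ) ≤ 1 - s)] at h1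
  -- h1 : e^{−αδ_F d(y,y′)}·(len y)^{s−1} ≤ L^{1−s}·(len y′)^{s−1}
  have hsplit : Real.exp (-(δ * (geo9K i).dist y y')) =
      Real.exp (-((δ - α * δF) * (geo9K i).dist y y')) * Real.exp (-(α * δF * (geo9K i).dist y y')) := by
    rw [← Real.exp_add]; congr 1; ring
  have hE : 0 ≤ C * Real.exp (-((δ - α * δF) * (geo9K i).dist y y')) := mul_nonneg hC (Real.exp_nonneg _)
  rw [hW, hW]
  calc (geo9K i).len y ^ (s - 1) * (C * Real.exp (-(δ * (geo9K i).dist y y')))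
      = C * Real.exp (-((δ - α * δF) * (geo9K i).dist y y')) * (Real.exp (-(α * δF * (geo9K i).dist y y')) * (geo9K i).len y ^ (s - 1)) := by
        rw [hsplit]; ring
    _ ≤ C * Real.exp (-((δ - α * δF) * (geo9K i).dist y y')) * ((geo9K i).L ^ (1 - s) * (geo9K i).len y' ^ (s - 1)) :=
        mul_le_mul_of_nonneg_left h1 hE
    _ = _ := by ring

end Reweight

/-! ## §2 ★★ The transported `J`-letter at the print-weighted classes -/

section Letter

variable (B : B9.Backgrounds) (cfg : B.Cfg → CfgY 𝔸 i) {R₀ : ℝ} {H₀ : Prop} {bI : FBondY i → IBondY i}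

/-- ★★ **`J_μ(U) : bHZP (taxiS U) s → bHZKP (taxiB U) s`** — the transported `J`-letter at the print-weighted classes, from the gauge-invariant plaquette binder
`hF : ‖U(∂p) − 1‖ ≤ ϑ_F·(L^{lev})⁻¹`: constant `cR39·CJT ℓ s ϑ_L·e^{δ r_Z}·L^{1−s}`, rate `δ − αδ_F` (`hasMaj_JcoKH_taxi` at `(ε, p) = (s, s)` + §1).
[cite: Balaban1985BackgroundPropagators, (3.3) p.390 + (3.35) p.396 + (3.40) p.397 + (3.43)–(3.45) p.398 + p.398 (remark after (3.47)); Balaban1984PropagatorsII, (2.51)–(2.54) pp.232–233 + Lemma 2.1 (2.60) p.234] -/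
theorem hasMaj_JcoKH_printWeight {dF : ℕ} {δF α L₀ : ℝ} (hFa : Facts347 (geo9K i) R₀ H₀ dF δF α L₀)
    (hcf : |i.cf| = (nKT (toKT i) : ℝ)) {s : ℝ} (hs0 : 0 ≤ s) (hs1 : s ≤ 1)
    (hβ1 : ∀ f : FBondY i, (geomT i.D).dist (β i.hN i.D i.hk (bI f)) (blkV1 i.hN i.D f) ≤ 1)
    (hbI0 : ∀ f : FBondY i, bI f = bI ⟨f.src, 0⟩) {U₁ : B.Cfg}
    (hU : ∀ (ν : Fin (d + 1)) (x : Site (PV d ℓ i.m i.K hd hL) 0), ‖(cfg U₁ ν x : 𝔸)‖ ≤ 1 ∧ ‖(((cfg U₁ ν x)⁻¹ : 𝔸ˣ) : 𝔸)‖ ≤ 1)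
    {ϑF : ℝ} (hϑF : 0 ≤ ϑF)
    (hF : ∀ (y : Site (PV d ℓ i.m i.K hd hL) 0) (μ' ν' : Fin (d + 1)),
      ‖(plaqV (cfg U₁) y μ' ν' : 𝔸) - 1‖ ≤ ϑF * ((((ℓ + 1 : ℕ) : ℝ)) ^ levY i (chartY i y))⁻¹)
    {δ : ℝ} (hδ : 0 ≤ δ) (μ : Fin (d + 1)) :
    HasMaj (bHZP (κ := κ) i b (taxiS i B cfg U₁) (R := R₀) (H := H₀) (s := s) hs0 hs1)
      (bHZKP (κ := κ) i b (taxiB i B cfg U₁) (R := R₀) (H := H₀) (s := s) hs0 hs1) (JcoKH i b B cfg μ U₁)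
      (fun y y' => cR39 b * CJT b ℓ s (2 * ((d : ℝ) + 1) * (((ℓ + 1 : ℕ) : ℝ)) ^ 2 * ϑF) * Real.exp (δ * rZ d ℓ (rNear d ℓ + 1)) *
        (geo9K i).L ^ (1 - s) * Real.exp (-((δ - α * δF) * (geo9K i).dist y y'))) := by
  have hϑL : 0 ≤ 2 * ((d : ℝ) + 1) * (((ℓ + 1 : ℕ) : ℝ)) ^ 2 * ϑF := by positivity
  have hC : 0 ≤ cR39 b * CJT b ℓ s (2 * ((d : ℝ) + 1) * (((ℓ + 1 : ℕ) : ℝ)) ^ 2 * ϑF) * Real.exp (δ * rZ d ℓ (rNear d ℓ + 1)) := by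
    have := cR39_nonneg b; have := CJT_nonneg (b := b) (ℓ := ℓ) (p := s) hϑL; positivity
  exact hasMaj_printWeight_of_transported i b (taxiS i B cfg U₁) (taxiB i B cfg U₁) hFa hcf hs0 hs1 hC
    (hasMaj_JcoKH_taxi i b B cfg (R₀ := R₀) (H₀ := H₀) hs0 hs1 le_rfl hβ1 hbI0 hU hϑF hF (fun _ _ h => dist_sIK_le_of_nearY i hβ1 h) hδ μ)

/-- ★★ **THE (R3′) BINDER: `J_μ(U)` OUT OF THE GRADED PRINT-WEIGHTED PIN `bHZPG (taxiS U) w` INTO `bHZKP (taxiB U) s`** at one exponent `0 < s < 1` with `0 < w s`: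
constant `(w s)⁻¹·cR39·CJT ℓ s ϑ_L·e^{δ r_Z}·L^{1−s}`, rate `δ − αδ_F`. [cite: Balaban1985BackgroundPropagators, (3.3) p.390 + (3.43)–(3.45) p.398; Balaban1984PropagatorsII, (2.51) p.232 + Lemma 2.1 (2.60) p.234] -/
theorem hasMaj_JcoKH_printGraded {dF : ℕ} {δF α L₀ : ℝ} (hFa : Facts347 (geo9K i) R₀ H₀ dF δF α L₀)
    (hcf : |i.cf| = (nKT (toKT i) : ℝ)) (w : ℝ → ℝ) (hw0 : ∀ s, 0 ≤ w s) (hw1 : ∀ s, w s ≤ 1) {s : ℝ} (hs0 : 0 < s) (hs1 : s < 1) (hws : 0 < w s)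
    (hβ1 : ∀ f : FBondY i, (geomT i.D).dist (β i.hN i.D i.hk (bI f)) (blkV1 i.hN i.D f) ≤ 1)
    (hbI0 : ∀ f : FBondY i, bI f = bI ⟨f.src, 0⟩) {U₁ : B.Cfg}
    (hU : ∀ (ν : Fin (d + 1)) (x : Site (PV d ℓ i.m i.K hd hL) 0), ‖(cfg U₁ ν x : 𝔸)‖ ≤ 1 ∧ ‖(((cfg U₁ ν x)⁻¹ : 𝔸ˣ) : 𝔸)‖ ≤ 1)
    {ϑF : ℝ} (hϑF : 0 ≤ ϑF)
    (hF : ∀ (y : Site (PV d ℓ i.m i.K hd hL) 0) (μ' ν' : Fin (d + 1)),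
      ‖(plaqV (cfg U₁) y μ' ν' : 𝔸) - 1‖ ≤ ϑF * ((((ℓ + 1 : ℕ) : ℝ)) ^ levY i (chartY i y))⁻¹)
    {δ : ℝ} (hδ : 0 ≤ δ) (μ : Fin (d + 1)) :
    HasMaj (bHZPG (κ := κ) i b (taxiS i B cfg U₁) (R := R₀) (H := H₀) w hw0 hw1)
      (bHZKP (κ := κ) i b (taxiB i B cfg U₁) (R := R₀) (H := H₀) (s := s) hs0.le hs1.le) (JcoKH i b B cfg μ U₁)
      (fun y y' => (w s)⁻¹ * (cR39 b * CJT b ℓ s (2 * ((d : ℝ) + 1) * (((ℓ + 1 : ℕ) : ℝ)) ^ 2 * ϑF) * Real.exp (δ * rZ d ℓ (rNear d ℓ + 1)) *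
        (geo9K i).L ^ (1 - s) * Real.exp (-((δ - α * δF) * (geo9K i).dist y y')))) := by
  have hϑL : 0 ≤ 2 * ((d : ℝ) + 1) * (((ℓ + 1 : ℕ) : ℝ)) ^ 2 * ϑF := by positivity
  have hK : ∀ a c : IBondY i, 0 ≤ cR39 b * CJT b ℓ s (2 * ((d : ℝ) + 1) * (((ℓ + 1 : ℕ) : ℝ)) ^ 2 * ϑF) * Real.exp (δ * rZ d ℓ (rNear d ℓ + 1)) *
      (geo9K i).L ^ (1 - s) * Real.exp (-((δ - α * δF) * (geo9K i).dist a c)) := fun a c => by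
    have := cR39_nonneg b; have := CJT_nonneg (b := b) (ℓ := ℓ) (p := s) hϑL
    have : 0 ≤ (geo9K i).L ^ (1 - s) := Real.rpow_nonneg (le_trans zero_le_one hFa.one_le_L) _
    positivity
  exact hasMaj_from_bHZPG i b (taxiS i B cfg U₁) w hw0 hw1 hs0 hs1 hws hK
    (hasMaj_JcoKH_printWeight i b B cfg hFa hcf hs0.le hs1.le hβ1 hbI0 hU hϑF hF hδ μ)

end Letter

/-! ## §3 ★★★ The producer landing at the graded print-weighted pin -/

section Producer

variable (B : B9.Backgrounds) (cfg : B.Cfg → CfgY 𝔸 i) {R : ℝ} {H : Prop} (hlen : ∀ y : (geo9K i).Site, 0 ≤ (geo9K i).len y)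
variable {bI : FBondY i → IBondY i} {F₁ : Type} [AddCommGroup F₁] [Module ℝ F₁]

/-- ★★★ **(3.43) AS A CLASS STATEMENT: THE PRODUCER LANDS ONCE IN `bHZPG (taxiS U) w`.**  For ANY source class `b₁` and ANY weights `0 ≤ w ≤ 1`: a sup member
`T : b₁ → 𝔠^{(−1)}` on the site carrier (`|Tμ| ≤ (Lʲη)·C₀e^{−δd}` — (3.42)₂ for `G′∇\*`, the certificate's `rgd2` for `R∇\*G₁`) and a gradient member `D_U∘T : b₁ → 𝔠⁽⁰⁾`
on the bond carrier (`|D_UTμ| ≤ C₁e^{−δd}` — (3.44)-type) give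
`HasMaj b₁ (bHZPG (taxiS U) w) T (L·(C₀e^{δ(r_near+1)} + (d+1)·(coordBound·Σ‖b_c‖)·C₁e^{δ(r_near+2(d+1)L²+2)})·e^{−δd})`.
[cite: Balaban1985BackgroundPropagators, Thm 3.1 (3.43) p.398 («B₀(β)(Lʲη)^{1−β}e^{−δ₀d}|λ|») + (3.42) p.397 + (3.44) p.398 + Thm 3.13 (3.152) p.426; Balaban1984PropagatorsII, (2.51)–(2.54) pp.232–233] -/
theorem hasMaj_into_bHZPG_of_grad (w : ℝ → ℝ) (hw0 : ∀ s, 0 ≤ w s) (hw1 : ∀ s, w s ≤ 1)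
    (hβ1 : ∀ f : FBondY i, (geomT i.D).dist (β i.hN i.D i.hk (bI f)) (blkV1 i.hN i.D f) ≤ 1)
    (hlev : ∀ f : FBondY i, lvl i.hN i.D i.hk (bI f) = (blkV1 i.hN i.D f).1.1) {δ : ℝ} (hδ : 0 ≤ δ)
    (hcf : |i.cf| = (nKT (toKT i) : ℝ)) {U : B.Cfg} (hU : ∀ ν x, UnitaryLike (cfg U ν x))
    {b₁ : BlockNorm (toB6 (geo9K i) R H) F₁} {T : F₁ →ₗ[ℝ] (XSK κ i → ℝ)} {C₀ C₁ : ℝ} (hC₀ : 0 ≤ C₀) (hC₁ : 0 ≤ C₁)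
    (hsup : HasMaj b₁ (cNormR R H (blkSK i (sIK i bI)) hlen (-1)) T (fun a a' => C₀ * Real.exp (-(δ * (geo9K i).dist a a'))))
    (hgrad : HasMaj b₁ (cNormR R H (blkBK i bI) hlen 0) (DvcoKH i b B cfg U ∘ₗ T) (fun a a' => C₁ * Real.exp (-(δ * (geo9K i).dist a a')))) :
    HasMaj b₁ (bHZPG (κ := κ) i b (taxiS i B cfg U) (R := R) (H := H) w hw0 hw1) T
      (fun y y' => (((ℓ + 1 : ℕ) : ℝ)) * (C₀ * Real.exp (δ * (rNear d ℓ + 1)) +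
          (((d : ℝ) + 1) * (coordBound39 b * basisBound39 b)) * C₁ * Real.exp (δ * (rNear d ℓ + (2 * ((d : ℝ) + 1) * (((ℓ + 1 : ℕ) : ℝ)) ^ 2 + 2)))) *
        Real.exp (-(δ * (geo9K i).dist y y'))) := by
  refine hasMaj_into_bHZPG_of_le i b (taxiS i B cfg U) w hw0 hw1 (fun a c => ?_) fun s hs0 hs1 =>
    hasMaj_into_bHZT_printWeight_of_grad i b B cfg hlen hs0.le hs1.le hβ1 hlev hδ hcf hU hC₀ hC₁ hsup hgrad
  have : 0 ≤ (((d : ℝ) + 1) * (coordBound39 b * basisBound39 b)) * C₁ *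
      Real.exp (δ * (rNear d ℓ + (2 * ((d : ℝ) + 1) * (((ℓ + 1 : ℕ) : ℝ)) ^ 2 + 2))) :=
    mul_nonneg (mul_nonneg (mul_nonneg (by positivity) (mul_nonneg (norm_nonneg _) (Finset.sum_nonneg fun _ _ => norm_nonneg _))) hC₁) (Real.exp_nonneg _)
  positivity

end Producer

end Literature.MathematicalPhysics.QuantumFieldTheory.Balaban1983to89.B9GradViaDivLettersPrintWeight

end
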